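import Mathlib
import HarnessLib
import Literature.Probability.LatticeModels.CriticalCorrWellDefined
import Summits.CriticalPhenomena.Ising3DConformalLimit.Theses.ModularQuarterTurn

/-!
# `FiniteVolumeScalingLimit` — finite-volume `+` boxes have the same pointwise scaling limit
(route ModularQuarterTurn, support item stmt-CriticalPhenomena-6498: PROOF)

If the renormalised critical correlators `ρ(δ)^n ⟨∏ᵢ σ_{[xᵢ/δ]}⟩⁺_{β_c}` on `ℤ³` converge to `S n`
locally uniformly on non-coincident configurations as `δ → 0⁺`, then there is a box growth
`L₀ : ℝ → ℕ` such that for every `L ≥ L₀` (pointwise) the `+` boundary condition box correlators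
`ρ(δ)^n ⟨∏ᵢ σ_{[xᵢ/δ]}⟩_{Λ_{L(δ)};β_c,+}` have the same locally uniform limit `S n`
(`finiteVolumeScalingLimit_proof`, literally the route decl `FiniteVolumeScalingLimit`).

Proof (limit interchange, qualitative). At a fixed mesh `δ > 0` only finitely many lattice data
matter on a compact exhaustion: the orders `n ≤ N(δ)` and the configurations `y : Fin n → ℤ³` with
all sites in `box 3 N(δ)`, where `N(δ) = ⌈(1/δ)²⌉₊`. For each such `(n, y)` the box expectations
`⟨∏ᵢ σ_{yᵢ}⟩_{B(L);β_c,+}` converge to `criticalCorr 3 n y` as `L → ∞` (the tree theorem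
`criticalCorr_wellDefined_holds`, Friedli–Velenik 2017 Thm. 3.17 by GKS, with
Aizenman–Duminil-Copin–Sidoravicius 2015 for `m*(β_c) = 0`), so a common threshold `L₀(δ)` makes
the renormalised error `< δ` for all of them and all `L ≥ L₀(δ)`. Given a compact neighbourhood
(a ball of radius `1`) of a non-coincident configuration `x₀` and `n`, for `δ` small the order `n`
and all lattice approximations `[x/δ]`, `x` in the ball, are among the controlled data, and the
error `δ` is eventually below any `ε`. No monotonicity and no rate is needed. No definitions are
introduced.
-/

namespace Summit.CriticalPhenomena.Ising3DConformalLimit.Theorems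

open Filter Topology Set
open Literature.Probability.LatticeModels
open Summit.CriticalPhenomena.Ising3DConformalLimit.Theses.ModularQuarterTurn

/-- **Uniform finite-volume control of finitely many correlators.** For `δ > 0`, a constant `C`
and a size `N`, there is a threshold `a` such that for every box `B(b)`, `b ≥ a`, every order
`n ≤ N` and every configuration `y : Fin n → ℤ³` with sites in `box 3 N`,
`dist (C^n · criticalCorr 3 n y) (C^n · ⟨∏ᵢ σ_{yᵢ}⟩_{B(b);β_c,+}) < δ`: finitely many convergent
sequences (`criticalCorr_wellDefined_holds`, Friedli–Velenik 2017, Thm. 3.17) are eventually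
simultaneously close to their limits. [cite: FriedliVelenik2017, Thm. 3.17] -/
theorem exists_box_threshold_criticalCorr (C δ : ℝ) (hδ : 0 < δ) (N : ℕ) :
    ∃ a : ℕ, ∀ b ≥ a, ∀ n ≤ N, ∀ y : Fin n → Site 3, (∀ i, y i ∈ box 3 N) →
      dist (C ^ n * criticalCorr 3 n y)
        (C ^ n * isingExpect (zdGraph 3) (box 3 b) (criticalBeta 3) 0 .plus (spinMonomial y)) < δ := by
  have hev : ∀ᶠ b : ℕ in atTop, ∀ n ∈ Finset.range (N + 1),
      ∀ y ∈ Fintype.piFinset (fun _ : Fin n => box 3 N),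
        dist (C ^ n * criticalCorr 3 n y)
          (C ^ n * isingExpect (zdGraph 3) (box 3 b) (criticalBeta 3) 0 .plus (spinMonomial y)) < δ := by
    refine (Finset.eventually_all _).2 fun n _ => (Finset.eventually_all _).2 fun y _ => ?_
    have h : Tendsto (fun L : ℕ => isingExpect (zdGraph 3) (box 3 L) (criticalBeta 3) 0 .plus
        (spinMonomial y)) atTop (𝓝 (criticalCorr 3 n y)) :=
      criticalCorr_wellDefined_holds (d := 3) (by norm_num) n y .plus (by simp)
    have h2 := Metric.tendsto_nhds.1 (h.const_mul (C ^ n)) δ hδ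
    exact h2.mono fun b hb => by rwa [dist_comm]
  obtain ⟨a, ha⟩ := eventually_atTop.1 hev
  refine ⟨a, fun b hb n hn y hy => ha b hb n (Finset.mem_range.2 (Nat.lt_succ_of_le hn)) y ?_⟩
  exact Fintype.mem_piFinset.2 hy

/-- Elementary mesh arithmetic: if `n + R + 1 ≤ t` with `n, R ≥ 0` then `n ≤ t²` and `R t ≤ t²`.
[folklore] -/
theorem mesh_arith_aux {t n R : ℝ} (hn : 0 ≤ n) (hR : 0 ≤ R) (ht : n + R + 1 ≤ t) :
    n ≤ t ^ 2 ∧ R * t ≤ t ^ 2 := by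
  have ht0 : 0 ≤ t := by linarith
  have ht1 : 1 ≤ t := by linarith
  constructor
  · nlinarith [mul_le_mul_of_nonneg_left ht1 ht0]
  · nlinarith [mul_le_mul_of_nonneg_right (show R ≤ t by linarith) ht0]

/-- **Lattice approximations of a bounded configuration lie in a controlled box.** If `0 < δ`,
`‖x₀‖ + 1 ≤ 1/δ - n - 1`-type smallness holds in the form `n + (‖x₀‖ + 1) + 1 ≤ 1/δ`, and `y` is in
the unit ball about `x₀`, then every coordinate site `[yᵢ/δ]` lies in `box 3 ⌈(1/δ)²⌉₊` and
`n ≤ ⌈(1/δ)²⌉₊`. [folklore] -/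
theorem latticeApprox_mem_box_of_mem_ball {n : ℕ} {x₀ y : Fin n → EuclideanSpace ℝ (Fin 3)}
    {δ : ℝ} (hδ : 0 < δ) (hsmall : (n : ℝ) + (‖x₀‖ + 1) + 1 ≤ 1 / δ)
    (hy : y ∈ Metric.ball x₀ 1) :
    n ≤ ⌈(1 / δ) ^ 2⌉₊ ∧ ∀ i, latticeApprox δ (y i) ∈ box 3 ⌈(1 / δ) ^ 2⌉₊ := by
  have hR : 0 ≤ ‖x₀‖ + 1 := by positivity
  obtain ⟨hn, hRt⟩ := mesh_arith_aux (Nat.cast_nonneg n) hR hsmall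
  have hceil : (1 / δ) ^ 2 ≤ (⌈(1 / δ) ^ 2⌉₊ : ℝ) := Nat.le_ceil _
  refine ⟨?_, fun i => ?_⟩
  · exact_mod_cast hn.trans hceil
  · rw [mem_box]
    intro j
    have hyn : ‖y‖ < ‖x₀‖ + 1 := norm_lt_of_mem_ball hy
    have hcoord : |y i j| ≤ ‖x₀‖ + 1 := by
      have h1 : ‖y i j‖ ≤ ‖y i‖ := PiLp.norm_apply_le (y i) j
      have h2 : ‖y i‖ ≤ ‖y‖ := norm_le_pi_norm y i
      rw [Real.norm_eq_abs] at h1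
      linarith
    have habs : |y i j / δ| ≤ (⌈(1 / δ) ^ 2⌉₊ : ℝ) := by
      rw [abs_div, abs_of_pos hδ, div_eq_mul_one_div]
      calc |y i j| * (1 / δ) ≤ (‖x₀‖ + 1) * (1 / δ) :=
            mul_le_mul_of_nonneg_right hcoord (by positivity)
        _ ≤ (1 / δ) ^ 2 := hRt
        _ ≤ _ := hceil
    obtain ⟨hlo, hhi⟩ := abs_le.1 habs
    rw [latticeApprox_apply]
    constructor
    · rw [Int.le_floor]
      push_cast
      exact hlo
    · have : ((⌊y i j / δ⌋ : ℤ) : ℝ) ≤ (⌈(1 / δ) ^ 2⌉₊ : ℝ) := (Int.floor_le _).trans hhi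
      exact_mod_cast this

/-- **`FiniteVolumeScalingLimit`** (item stmt-CriticalPhenomena-6498, route ModularQuarterTurn): if
`ρ(δ)^n ⟨∏ᵢ σ_{[xᵢ/δ]}⟩⁺_{β_c} → S n` locally uniformly on non-coincident configurations of `ℝ³`,
then there is `L₀ : ℝ → ℕ` such that for every box growth `L ≥ L₀` the `+` boundary condition box
correlators `ρ(δ)^n ⟨∏ᵢ σ_{[xᵢ/δ]}⟩_{Λ_{L(δ)};β_c,+}` converge to the same `S n`, locally uniformly
on non-coincident configurations. Limit interchange: at each mesh only finitely many lattice data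
matter on a compact exhaustion (`latticeApprox_mem_box_of_mem_ball`), and the `+` box states
converge on every spin monomial (`criticalCorr_wellDefined_holds`; Friedli–Velenik 2017, Thm. 3.17,
GKS), so `L₀(δ)` can be chosen with renormalised error `< δ`
(`exists_box_threshold_criticalCorr`). The positivity hypothesis on `ρ` is not needed.
[cite: FriedliVelenik2017, Thm. 3.17] -/
theorem finiteVolumeScalingLimit_proof : FiniteVolumeScalingLimit := by
  intro ρ S _hρ hlim
  have key : ∀ δ : ℝ, ∃ a : ℕ, 0 < δ → ∀ b ≥ a, ∀ n ≤ ⌈(1 / δ) ^ 2⌉₊, ∀ y : Fin n → Site 3,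
      (∀ i, y i ∈ box 3 ⌈(1 / δ) ^ 2⌉₊) →
        dist (ρ δ ^ n * criticalCorr 3 n y)
          (ρ δ ^ n * isingExpect (zdGraph 3) (box 3 b) (criticalBeta 3) 0 .plus (spinMonomial y))
            < δ := by
    intro δ
    by_cases hδ : 0 < δ
    · obtain ⟨a, ha⟩ := exists_box_threshold_criticalCorr (ρ δ) δ hδ ⌈(1 / δ) ^ 2⌉₊
      exact ⟨a, fun _ => ha⟩
    · exact ⟨0, fun h => absurd h hδ⟩
  choose L₀ hL₀ using key
  refine ⟨L₀, fun L hL n => ?_⟩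
  refine Metric.tendstoLocallyUniformlyOn_iff.2 fun ε hε x₀ hx₀ => ?_
  obtain ⟨t, ht, hev⟩ :=
    Metric.tendstoLocallyUniformlyOn_iff.1 (hlim n) (ε / 2) (half_pos hε) x₀ hx₀
  refine ⟨t ∩ Metric.ball x₀ 1,
    inter_mem ht (mem_nhdsWithin_of_mem_nhds (Metric.ball_mem_nhds x₀ one_pos)), ?_⟩
  set A : ℝ := (n : ℝ) + (‖x₀‖ + 1) + 1 with hA
  have hApos : 0 < A := by positivity
  have hc : 0 < min (ε / 2) (1 / A) := lt_min (half_pos hε) (by positivity)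
  filter_upwards [hev, Ioo_mem_nhdsGT hc] with δ hδ hδc y hy
  obtain ⟨hyt, hyb⟩ := hy
  have hδ0 : 0 < δ := hδc.1
  have hδε : δ < ε / 2 := hδc.2.trans_le (min_le_left _ _)
  have hδA : δ < 1 / A := hδc.2.trans_le (min_le_right _ _)
  have hsmall : A ≤ 1 / δ := by
    rw [le_div_iff₀ hδ0]
    have := (lt_div_iff₀ hApos).1 hδA
    linarith
  obtain ⟨hnM, hyM⟩ := latticeApprox_mem_box_of_mem_ball hδ0 hsmall hyb
  have hfin := hL₀ δ hδ0 (L δ) (hL δ) n hnM (fun i => latticeApprox δ (y i)) hyM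
  have h1 : dist (S n y) (rescaledCorrelator (criticalCorr 3) ρ n δ y) < ε / 2 := hδ y hyt
  calc dist (S n y) (ρ δ ^ n * isingExpect (zdGraph 3) (box 3 (L δ)) (criticalBeta 3) 0 .plus
          (spinMonomial fun i => latticeApprox δ (y i)))
        ≤ dist (S n y) (rescaledCorrelator (criticalCorr 3) ρ n δ y)
          + dist (rescaledCorrelator (criticalCorr 3) ρ n δ y)
            (ρ δ ^ n * isingExpect (zdGraph 3) (box 3 (L δ)) (criticalBeta 3) 0 .plus
              (spinMonomial fun i => latticeApprox δ (y i))) := dist_triangle _ _ _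
    _ < ε / 2 + δ := add_lt_add h1 hfin
    _ < ε := by linarith

end Summit.CriticalPhenomena.Ising3DConformalLimit.Theorems
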